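import Summits.Schanuel.Schanuel.Theorems.RootDecomp1JBinderKernel

/-!
# First failures are blocks: the structure of the residual K₃ of route `RootDecomp1J` (supports `stmt-Schanuel-30523`)

`route-Schanuel-RootDecomp1J` rev 5: `closes : A → P3 → P5 → T → Λ → K₁ → K₂ → Schanuel`, K₂ split as
`G₂ ∧ K₃` (glue 30524 closed); K₃ = `SchanuelOverPairClosedFields` (stmt-Schanuel-30523) = `Rel(⊤|𝓚₂)` is the
route's declared residual.  `RootDecomp1JRankKernel` read its first CELL (rank `4`, circuits).  This file reads
its first FAILURE, wherever it is, UNCONDITIONALLY: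

* **the LOCAL block criterion** `hblock_of_cost_le_local` — `RootDecomp1JGapLemma.hblock_of_cost_le` with the
  gap hypothesis replaced by what its proof actually uses: every free sub-system `τ ⊂ span_ℚ w` of length
  `1 ≤ c < s` costs `≥ c` over `ℚ(y, e^y)` (that is exactly what a failure of MINIMAL RANK has below it);
* **first failures are blocks** `hblock_of_relOnRank` — if every instance of `Rel(E''|E)` of rank `≤ s` holds,
  an instance of rank `s + 1` and cost `≤ s + 1` is a hereditary `(s+1)`-block over `E`, inside `E^{B≤s+1}`;
* **`Rel(E''|E) ⟺ BlockExactOn E E''`** (`forall_relOnRank_iff_blockExactOn`, `rel_iff_blockExactOn`; ANY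
  `E`, `E''`, no block-closedness): relative Schanuel is the statement that no `ℚ`-free hereditary block is
  OVER-DETERMINED (blocks cost `≤` their size by definition). For the item: `pK3_iff_blockExactOn :
  SchanuelOverPairClosedFields ↔ BlockExactOn 𝓚₂ ⊤`, `pG2_iff_blockExactOn` (G₂ = 30522);
* **DEPTH ONE** `forall_relOnRank_top_iff_forall_blockStep` — `Rel(⊤|E) ↔ ∀ m, Rel(E^{B≤m}|E)`; for the item
  `pK3_iff_forall_blockStep`: a first failure of K₃ is a free `m`-block over `𝓚₂` adjoined in ONE block step
  (and `m ≥ 4` by the rank kernel) — iterated or mixed adjunctions never carry a first failure;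
* at the bottom of the flag, **Schanuel's conjecture `⟺` every `ℚ`-free hereditary block over `ℚ` is
  GENERIC** (`schanuel_iff_blocks_generic`: `trdeg ℚ(w, e^w) = |w|`; with `RootDecomp1JKhovanskiiBlocks` this
  covers every `ℚ`-free non-degenerate zero of a square exponential-polynomial system over `ℤ`);
* **RANK ESCALATION** (`exists_pow_free`, `relAt_of_relAt_succ`, `forall_relOnRank_iff_relAt_ge`): over a
  RELATIVELY ALGEBRAICALLY CLOSED base (`RelAlgClosed`; every block hull `𝓚_N(E)`, `N ≥ 1`, every curve hull)
  a rank-`M` failure padded by a free POWER of one of its coordinates is a rank-`(M+1)` failure, so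
  `Rel ↔ Rel[rank ≥ M₀]` for EVERY `M₀`; for the item **`pK3_iff_rank_ge (M₀) : SchanuelOverPairClosedFields ↔
  K₃[rank ≥ M₀]`** (and `pK2_iff_rank_ge`, `pG2_iff_rank_ge`).

Reading for the decomposition cell: the RANK, BLOCK-SIZE and DEPTH axes of K₃ carry no decomposition (every
co-finite rank-piece IS K₃, ranks `≤ 3` are theorems; the depth-one piece IS K₃).  `Rel(E''|E)` is written here
as `∀ M, RelOnRank E E'' M` (`RootDecomp1JBlockHulls.RelOnRank`; `rel_iff_forall_relOnRank` is the bridge to the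
written-out form used by `RootDecomp1DFlagSplit`), the item spaces `𝓚 = curveHull 𝓜`, `𝓚₂ = blockHull 2 𝓚`
literally as in `Theses/RootDecomp1J.lean` (`RootDecomp1JRankKernel.pairHullLit_eq`).

Provenance: decomposition cell `decomp-schanuel`, lens 3, NODE v11 §34 (kernel-checked there). Nothing here
proves Schanuel or K₃; the route stays DRAFT.
-/

set_option linter.dupNamespace false

noncomputable section

open Complex IntermediateField
open Literature.Barriers.Schanuel (trdeg_mono)
open Summit.Schanuel.Schanuel.Theorems.RootDecomp1DFlagSplit (trdeg_adjoin_union_eq_add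
  trdeg_adjoin_le_cardinalMk trdeg_gens_lt_aleph0 rel_iff_add disjoint_span_of_linearIndependent_mkQ
  schanuelOn_of_relOn)
open Summit.Schanuel.Schanuel.Theorems.RootDecomp1JKhovanskiiBlocks (mem_and_isAlgebraic_exp_of_mem_span
  mem_and_isAlgebraic_exp_of_mem_span_set reltrdeg_le_of_isAlgebraic trdeg_witnessField_lt_aleph0)
open Summit.Schanuel.Schanuel.Theorems.RootDecomp1JBlockHulls
open Summit.Schanuel.Schanuel.Theorems.RootDecomp1JGapLemma
open Summit.Schanuel.Schanuel.Theorems.RootDecomp1JRankKernel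
open Summit.Schanuel.Schanuel.Theses.RootDecomp1J

namespace Summit.Schanuel.Schanuel.Theorems.RootDecomp1JFirstFailure

/-! ### §0 Tools -/

set_option synthInstance.maxHeartbeats 400000 in
/-- (private copy, as in `RootDecomp1JGapLemma`; landed public twin
`Literature.Barriers.Schanuel.trdeg_adjoin_union_eq_of_isAlgebraic_adjoin` in NesterenkoModularScopeConjectureProofs,
not in this import cone) `trdeg_K K(S ∪ T) = trdeg_K K(S)` when `T` is algebraic over `K(S)`. [folklore] -/
private theorem trdeg_adjoin_union_eq_of_isAlgebraic {K E : Type*} [Field K] [Field E] [Algebra K E]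
    (S T : Set E) (hT : ∀ x ∈ T, IsAlgebraic (adjoin K S) x) :
    Algebra.trdeg K (adjoin K (S ∪ T)) = Algebra.trdeg K (adjoin K S) := by
  have htower := trdeg_add_eq K (adjoin K S) (A := adjoin (adjoin K S) T)
  have heq : Algebra.trdeg K (adjoin (adjoin K S) T) = Algebra.trdeg K (adjoin K (S ∪ T)) := by
    rw [← (equivOfEq (adjoin_adjoin_left K S T)).trdeg_eq]
    rfl
  haveI : Algebra.IsAlgebraic (adjoin K S) (adjoin (adjoin K S) T) :=
    IntermediateField.isAlgebraic_adjoin fun x hx => (hT x hx).isIntegral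
  have h0 : Algebra.trdeg (adjoin K S) (adjoin (adjoin K S) T) = 0 := trdeg_eq_zero
  rw [h0, add_zero, heq] at htower
  exact htower.symm

/-- `Rel(E''|E)[rank ≤ M]` is antitone in the upper space. -/
theorem relOnRank_mono_right {E E' E'' : Submodule ℚ ℂ} (h : E' ≤ E'') {M : ℕ} (hR : RelOnRank E E'' M) :
    RelOnRank E E' M := fun k m y z hm hy hz hli => hR k m y z hm hy (fun j => h (hz j)) hli

/-- `Rel(E''|E)` (written out, as in `RootDecomp1DFlagSplit`) `↔ ∀ M, Rel(E''|E)[rank ≤ M]`. -/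
theorem rel_iff_forall_relOnRank (E E'' : Submodule ℚ ℂ) :
    (∀ (k m : ℕ) (y : Fin k → ℂ) (z : Fin m → ℂ), (∀ i, y i ∈ E) → (∀ j, z j ∈ E'') →
      LinearIndependent ℚ ((E).mkQ ∘ z) →
      (m : Cardinal) ≤ Algebra.trdeg ↥(adjoin ℚ (Set.range y ∪ Set.range (cexp ∘ y)))
        ↥(adjoin ↥(adjoin ℚ (Set.range y ∪ Set.range (cexp ∘ y)))
          (Set.range z ∪ Set.range (cexp ∘ z)))) ↔ ∀ M, RelOnRank E E'' M :=
  ⟨fun h _ k m y z _ hy hz hli => h k m y z hy hz hli,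
    fun h k m y z hy hz hli => h m k m y z le_rfl hy hz hli⟩

/-- The generators `y ⊂ ⊥` and `e^y` are `0` and `1`: `trdeg ℚ(y, e^y) = 0`. [folklore] -/
theorem trdeg_gens_eq_zero_of_mem_bot {k : ℕ} {y : Fin k → ℂ} (hy : ∀ i, y i ∈ (⊥ : Submodule ℚ ℂ)) :
    Algebra.trdeg ℚ ↥(adjoin ℚ (Set.range y ∪ Set.range (cexp ∘ y))) = 0 := by
  haveI : Algebra.IsAlgebraic ℚ ↥(adjoin ℚ (Set.range y ∪ Set.range (cexp ∘ y))) := by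
    refine IntermediateField.isAlgebraic_adjoin ?_
    rintro x (⟨i, rfl⟩ | ⟨i, rfl⟩)
    · rw [show y i = 0 from (Submodule.mem_bot ℚ).mp (hy i)]; exact isIntegral_zero
    · rw [Function.comp_apply, show y i = 0 from (Submodule.mem_bot ℚ).mp (hy i), Complex.exp_zero]
      exact isIntegral_one
  exact trdeg_eq_zero

/-- The witness field of a block over `⊥` is `ℚ(0, 1)`: `trdeg ℚ(Y, e^Y) = 0` for `Y ⊆ {0}`. [folklore] -/
theorem trdeg_witnessField_eq_zero_of_subset_bot {Y : Finset ℂ}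
    (hY : (↑Y : Set ℂ) ⊆ ((⊥ : Submodule ℚ ℂ) : Set ℂ)) :
    Algebra.trdeg ℚ ↥(adjoin ℚ ((↑Y : Set ℂ) ∪ cexp '' ↑Y)) = 0 := by
  haveI : Algebra.IsAlgebraic ℚ ↥(adjoin ℚ ((↑Y : Set ℂ) ∪ cexp '' ↑Y)) := by
    refine IntermediateField.isAlgebraic_adjoin ?_
    rintro x (hx | ⟨t, ht, rfl⟩)
    · rw [show x = 0 from (Submodule.mem_bot ℚ).mp (hY hx)]; exact isIntegral_zero
    · rw [show t = 0 from (Submodule.mem_bot ℚ).mp (hY ht), Complex.exp_zero]; exact isIntegral_one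
  exact trdeg_eq_zero

/-- `(g, e^g)` costs at most one over any field over which `g` is algebraic. [folklore] -/
theorem reltrdeg_pair_le_one_of_isAlgebraic (F : IntermediateField ℚ ℂ) {g : ℂ} (hg : IsAlgebraic F g) :
    Algebra.trdeg F ↥(adjoin F ({g, cexp g} : Set ℂ)) ≤ 1 := by
  rw [Set.insert_eq g ({cexp g} : Set ℂ)]
  have h0 : Algebra.trdeg F ↥(adjoin F ({g} : Set ℂ)) = 0 :=
    reltrdeg_eq_zero_of_isAlgebraic F {g} fun x hx => by rw [Set.mem_singleton_iff.mp hx]; exact hg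
  calc Algebra.trdeg F ↥(adjoin F (({g} : Set ℂ) ∪ {cexp g}))
      = Algebra.trdeg F ↥(adjoin F ({g} : Set ℂ)) +
          Algebra.trdeg ↥(adjoin F ({g} : Set ℂ)) ↥(adjoin ↥(adjoin F ({g} : Set ℂ)) ({cexp g} : Set ℂ)) :=
        trdeg_adjoin_union_eq_add (K := F) _ _
    _ ≤ 0 + 1 := by
        rw [h0]
        refine add_le_add le_rfl ?_
        calc Algebra.trdeg ↥(adjoin F ({g} : Set ℂ)) ↥(adjoin ↥(adjoin F ({g} : Set ℂ)) ({cexp g} : Set ℂ))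
            ≤ Cardinal.mk ({cexp g} : Set ℂ) := trdeg_adjoin_le_cardinalMk _
          _ = 1 := Cardinal.mk_singleton _
    _ = 1 := zero_add 1

/-! ### §1 The local block criterion -/

open Submodule in
/-- **THE LOCAL BLOCK CRITERION.** A `ℚ`-free-modulo-`E` `s`-tuple `w` of cost `≤ s` over `K = ℚ(y, e^y)`,
`y ⊂ E`, ALL OF WHOSE FREE SUB-SYSTEMS `τ ⊂ span_ℚ w` of length `1 ≤ c < s` cost `≥ c` over `K`, is a
hereditary `s`-block over `E` with witness set `{y}` — the proof of `RootDecomp1JGapLemma.hblock_of_cost_le`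
verbatim (modular selection `exists_modular_split`, two towers, one base change), which never used more of the
gap hypothesis than this. A failure of `Rel(E''|E)` of MINIMAL rank satisfies the hypothesis. -/
theorem hblock_of_cost_le_local {E : Submodule ℚ ℂ} {s : ℕ}
    {k : ℕ} {y : Fin k → ℂ} {w : Fin s → ℂ} (hy : ∀ i, y i ∈ E)
    (hw : LinearIndependent ℚ (E.mkQ ∘ w))
    (hmin : ∀ (c : ℕ) (τ : Fin c → ℂ), 1 ≤ c → c < s → (∀ i, τ i ∈ span ℚ (Set.range w)) →
      LinearIndependent ℚ (E.mkQ ∘ τ) →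
      (c : Cardinal) ≤ Algebra.trdeg ↥(adjoin ℚ (Set.range y ∪ Set.range (cexp ∘ y)))
        ↥(adjoin ↥(adjoin ℚ (Set.range y ∪ Set.range (cexp ∘ y))) (Set.range τ ∪ Set.range (cexp ∘ τ))))
    (hcost : Algebra.trdeg ↥(adjoin ℚ (Set.range y ∪ Set.range (cexp ∘ y)))
      ↥(adjoin ↥(adjoin ℚ (Set.range y ∪ Set.range (cexp ∘ y))) (Set.range w ∪ Set.range (cexp ∘ w))) ≤
      (s : Cardinal)) :
    HBlock E w := by
  classical
  refine ⟨Finset.univ.image y, ?_, fun T hYT k' ρ hspan => ?_⟩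
  · intro t ht
    obtain ⟨i, -, rfl⟩ := Finset.mem_image.mp (Finset.mem_coe.mp ht)
    exact hy i
  set Gy := Set.range y ∪ Set.range (cexp ∘ y) with hGy
  set Sw := Set.range w ∪ Set.range (cexp ∘ w) with hSw
  set GT : Set ℂ := (↑T : Set ℂ) ∪ cexp '' ↑T with hGT
  have hfinY : Algebra.trdeg ℚ ↥(adjoin ℚ Gy) < Cardinal.aleph0 := trdeg_gens_lt_aleph0 y
  have hfinT : Algebra.trdeg ℚ ↥(adjoin ℚ GT) < Cardinal.aleph0 := trdeg_witnessField_lt_aleph0 T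
  have hw_li : LinearIndependent ℚ w := LinearIndependent.of_comp E.mkQ hw
  -- (1) modular selection
  obtain ⟨u, c, b, τ, huc, huk, hbV, hτT, hτV, hτli, hwbτ⟩ :=
    exists_modular_split hw_li (↑T) ρ hspan
  set Sb := Set.range b ∪ Set.range (cexp ∘ b) with hSb
  set Sτ := Set.range τ ∪ Set.range (cexp ∘ τ) with hSτ
  have hτ_free : LinearIndependent ℚ (E.mkQ ∘ τ) := linearIndependent_mkQ_of_mem_span hw hτli hτV
  -- (2) `y ⊆ T`
  have hyT : ∀ i, y i ∈ (↑T : Set ℂ) := fun i =>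
    Finset.mem_coe.mpr (hYT (Finset.mem_image_of_mem y (Finset.mem_univ i)))
  have hGyT : Gy ⊆ GT := by
    rintro x (⟨i, rfl⟩ | ⟨i, rfl⟩)
    · exact Or.inl (hyT i)
    · exact Or.inr ⟨y i, hyT i, rfl⟩
  -- (3) algebraicity: `b, τ, e^b, e^τ / ℚ(y, w, e^…)`; `w, e^w / ℚ(G, τ, b, e^…)`; `τ, e^τ / ℚ(T, e^T)`
  have hSw_le : ∀ G : Set ℂ, adjoin ℚ Sw ≤ adjoin ℚ (G ∪ Sw) := fun G =>
    adjoin.mono _ _ _ Set.subset_union_right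
  have halg_bτ : ∀ x ∈ Sb ∪ Sτ, IsAlgebraic (adjoin ℚ (Gy ∪ Sw)) x := by
    rintro x (hx | hx)
    · exact isAlgebraic_gens_of_mem_span w hbV _ (hSw_le Gy) x hx
    · exact isAlgebraic_gens_of_mem_span w hτV _ (hSw_le Gy) x hx
  have hbτ_sub : ∀ G : Set ℂ,
      (Set.range b ∪ Set.range τ) ∪ cexp '' (Set.range b ∪ Set.range τ) ⊆ (G ∪ Sτ) ∪ Sb := by
    intro G
    rintro x ((⟨i, rfl⟩ | ⟨i, rfl⟩) | ⟨v, (⟨i, rfl⟩ | ⟨i, rfl⟩), rfl⟩)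
    · exact Or.inr (Or.inl ⟨i, rfl⟩)
    · exact Or.inl (Or.inr (Or.inl ⟨i, rfl⟩))
    · exact Or.inr (Or.inr ⟨i, rfl⟩)
    · exact Or.inl (Or.inr (Or.inr ⟨i, rfl⟩))
  have halg_w : ∀ G : Set ℂ, ∀ x ∈ Sw, IsAlgebraic (adjoin ℚ ((G ∪ Sτ) ∪ Sb)) x := fun G =>
    isAlgebraic_gens_of_mem_span_set hwbτ _ (adjoin.mono _ _ _ (hbτ_sub G))
  have halg_τT : ∀ x ∈ Sτ, IsAlgebraic (adjoin ℚ GT) x :=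
    isAlgebraic_gens_of_mem_span_set hτT _ le_rfl
  -- (4) transcendence degrees over `ℚ`
  -- (the `Algebra ℚ ↥(adjoin ℚ _)` instance paths of the generic lemmas are only defeq: `calc`, not `rw`)
  have hset : (Gy ∪ Sw) ∪ (Sb ∪ Sτ) = ((Gy ∪ Sτ) ∪ Sb) ∪ Sw := by
    ext x; simp only [Set.mem_union]; tauto
  have e1 : Algebra.trdeg ℚ ↥(adjoin ℚ (Gy ∪ Sw)) = Algebra.trdeg ℚ ↥(adjoin ℚ ((Gy ∪ Sτ) ∪ Sb)) :=
    calc Algebra.trdeg ℚ ↥(adjoin ℚ (Gy ∪ Sw))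
        = Algebra.trdeg ℚ ↥(adjoin ℚ ((Gy ∪ Sw) ∪ (Sb ∪ Sτ))) :=
          (trdeg_adjoin_union_eq_of_isAlgebraic (Gy ∪ Sw) (Sb ∪ Sτ) halg_bτ).symm
      _ = Algebra.trdeg ℚ ↥(adjoin ℚ (((Gy ∪ Sτ) ∪ Sb) ∪ Sw)) := by rw [hset]
      _ = Algebra.trdeg ℚ ↥(adjoin ℚ ((Gy ∪ Sτ) ∪ Sb)) :=
          trdeg_adjoin_union_eq_of_isAlgebraic ((Gy ∪ Sτ) ∪ Sb) Sw (halg_w Gy)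
  have e2 : Algebra.trdeg ℚ ↥(adjoin ℚ (GT ∪ Sw)) ≤ Algebra.trdeg ℚ ↥(adjoin ℚ ((GT ∪ Sτ) ∪ Sb)) :=
    calc Algebra.trdeg ℚ ↥(adjoin ℚ (GT ∪ Sw))
        ≤ Algebra.trdeg ℚ ↥(adjoin ℚ (((GT ∪ Sτ) ∪ Sb) ∪ Sw)) :=
          trdeg_mono (adjoin.mono _ _ _ (Set.union_subset_union_left _
            (Set.subset_union_left.trans Set.subset_union_left)))
      _ = Algebra.trdeg ℚ ↥(adjoin ℚ ((GT ∪ Sτ) ∪ Sb)) :=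
          trdeg_adjoin_union_eq_of_isAlgebraic ((GT ∪ Sτ) ∪ Sb) Sw (halg_w GT)
  have e3 : Algebra.trdeg ℚ ↥(adjoin ℚ (GT ∪ Sτ)) = Algebra.trdeg ℚ ↥(adjoin ℚ GT) :=
    trdeg_adjoin_union_eq_of_isAlgebraic GT Sτ halg_τT
  have t1 := trdeg_adjoin_union_eq_add (K := ℚ) (Gy ∪ Sτ) Sb
  have t2 := trdeg_adjoin_union_eq_add (K := ℚ) (GT ∪ Sτ) Sb
  have bc : Algebra.trdeg ↥(adjoin ℚ (GT ∪ Sτ)) ↥(adjoin ↥(adjoin ℚ (GT ∪ Sτ)) Sb) ≤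
      Algebra.trdeg ↥(adjoin ℚ (Gy ∪ Sτ)) ↥(adjoin ↥(adjoin ℚ (Gy ∪ Sτ)) Sb) :=
    Literature.NumberTheory.Transcendental.trdeg_adjoin_le_of_le
      (adjoin.mono _ _ _ (Set.union_subset_union_left _ hGyT)) Sb
  -- (5) the cost of `(b, e^b)` over `ℚ(T, τ, e^T, e^τ)` is `≤ u`
  have hcost' : Algebra.trdeg ℚ ↥(adjoin ℚ (Gy ∪ Sw)) ≤
      Algebra.trdeg ℚ ↥(adjoin ℚ Gy) + (s : Cardinal) := (rel_le_iff_add Gy Sw hfinY s).1 hcost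
  have hr : Algebra.trdeg ↥(adjoin ℚ (GT ∪ Sτ)) ↥(adjoin ↥(adjoin ℚ (GT ∪ Sτ)) Sb) ≤ (u : Cardinal) := by
    rcases Nat.eq_zero_or_pos u with hu | hu
    · subst hu
      have hSb0 : Sb = ∅ := by rw [hSb]; simp [Set.range_eq_empty]
      calc Algebra.trdeg ↥(adjoin ℚ (GT ∪ Sτ)) ↥(adjoin ↥(adjoin ℚ (GT ∪ Sτ)) Sb)
          ≤ Cardinal.mk Sb := trdeg_adjoin_le_cardinalMk _
        _ = 0 := by rw [hSb0]; exact Cardinal.mk_eq_zero _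
        _ ≤ ((0 : ℕ) : Cardinal) := by simp
    · have hIH : Algebra.trdeg ℚ ↥(adjoin ℚ Gy) + (c : Cardinal) ≤
          Algebra.trdeg ℚ ↥(adjoin ℚ (Gy ∪ Sτ)) := by
        rcases Nat.eq_zero_or_pos c with hc | hc
        · rw [hc, Nat.cast_zero, add_zero]
          exact trdeg_mono (adjoin.mono _ _ _ Set.subset_union_left)
        · exact (rel_iff_add Gy Sτ hfinY c).1 (hmin c τ hc (by omega) hτV hτ_free)
      obtain ⟨d, hd⟩ := Cardinal.lt_aleph0.1 hfinY
      have key : Algebra.trdeg ↥(adjoin ℚ (Gy ∪ Sτ)) ↥(adjoin ↥(adjoin ℚ (Gy ∪ Sτ)) Sb) +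
          ((c + d : ℕ) : Cardinal) ≤ (u : Cardinal) + ((c + d : ℕ) : Cardinal) := by
        calc Algebra.trdeg ↥(adjoin ℚ (Gy ∪ Sτ)) ↥(adjoin ↥(adjoin ℚ (Gy ∪ Sτ)) Sb) +
              ((c + d : ℕ) : Cardinal)
            = (Algebra.trdeg ℚ ↥(adjoin ℚ Gy) + (c : Cardinal)) +
                Algebra.trdeg ↥(adjoin ℚ (Gy ∪ Sτ)) ↥(adjoin ↥(adjoin ℚ (Gy ∪ Sτ)) Sb) := by
              rw [hd]; push_cast; ring
          _ ≤ Algebra.trdeg ℚ ↥(adjoin ℚ (Gy ∪ Sτ)) +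
                Algebra.trdeg ↥(adjoin ℚ (Gy ∪ Sτ)) ↥(adjoin ↥(adjoin ℚ (Gy ∪ Sτ)) Sb) :=
              add_le_add hIH le_rfl
          _ = Algebra.trdeg ℚ ↥(adjoin ℚ ((Gy ∪ Sτ) ∪ Sb)) := t1.symm
          _ = Algebra.trdeg ℚ ↥(adjoin ℚ (Gy ∪ Sw)) := e1.symm
          _ ≤ Algebra.trdeg ℚ ↥(adjoin ℚ Gy) + (s : Cardinal) := hcost'
          _ = (u : Cardinal) + ((c + d : ℕ) : Cardinal) := by rw [hd, ← huc]; push_cast; ring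
      exact bc.trans ((Cardinal.add_nat_le_add_nat_iff (c + d)).1 key)
  -- (6) conclusion over the witness field `ℚ(T, e^T)`
  refine (rel_le_iff_add GT Sw hfinT k').2 ?_
  calc Algebra.trdeg ℚ ↥(adjoin ℚ (GT ∪ Sw))
      ≤ Algebra.trdeg ℚ ↥(adjoin ℚ ((GT ∪ Sτ) ∪ Sb)) := e2
    _ = Algebra.trdeg ℚ ↥(adjoin ℚ (GT ∪ Sτ)) +
          Algebra.trdeg ↥(adjoin ℚ (GT ∪ Sτ)) ↥(adjoin ↥(adjoin ℚ (GT ∪ Sτ)) Sb) := t2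
    _ ≤ Algebra.trdeg ℚ ↥(adjoin ℚ GT) + (u : Cardinal) := by rw [e3]; exact add_le_add le_rfl hr
    _ ≤ Algebra.trdeg ℚ ↥(adjoin ℚ GT) + (k' : Cardinal) :=
        add_le_add le_rfl (by exact_mod_cast huk)

/-! ### §2 First failures are blocks; `Rel ↔ BlockExact`; depth one -/

/-- `BlockExactOn E E''`: every hereditary block over `E` with coordinates in `E''` that is `ℚ`-free
modulo `E` is EXACT — it costs at least (hence, being a block, exactly) its size over every `E`-field. -/
def BlockExactOn (E E'' : Submodule ℚ ℂ) : Prop :=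
  ∀ (n : ℕ) (w : Fin n → ℂ), (∀ j, w j ∈ E'') → HBlock E w → LinearIndependent ℚ (E.mkQ ∘ w) →
    ∀ (k : ℕ) (y : Fin k → ℂ), (∀ i, y i ∈ E) →
      (n : Cardinal) ≤ Algebra.trdeg ↥(adjoin ℚ (Set.range y ∪ Set.range (cexp ∘ y)))
        ↥(adjoin ↥(adjoin ℚ (Set.range y ∪ Set.range (cexp ∘ y))) (Set.range w ∪ Set.range (cexp ∘ w)))

/-- `Rel(E''|E)` (all ranks) implies `BlockExactOn E E''`: blocks cost at most their size by definition. -/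
theorem blockExactOn_of_forall_relOnRank {E E'' : Submodule ℚ ℂ} (h : ∀ M, RelOnRank E E'' M) :
    BlockExactOn E E'' :=
  fun n w hwE _ hw k y hy => h n k n y w le_rfl hy hwE hw

/-- `BlockExactOn E ·` is antitone in the ambient space: it restricts from `E''` to any `E' ≤ E''`. -/
theorem blockExactOn_mono_right {E E' E'' : Submodule ℚ ℂ} (h : E' ≤ E'') (hB : BlockExactOn E E'') :
    BlockExactOn E E' := fun n w hwE hBw hw k y hy => hB n w (fun j => h (hwE j)) hBw hw k y hy

open Submodule in
/-- **FIRST FAILURES ARE BLOCKS.** If every instance of `Rel(E''|E)` of rank `≤ s` holds, then an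
instance `(y; w)` of rank `s + 1` and cost `≤ s + 1` — in particular a FIRST FAILURE — is a hereditary
`(s+1)`-block over `E` (witness `{y}`), hence lies in the single block step `E^{B≤s+1}`. -/
theorem hblock_of_relOnRank {E E'' : Submodule ℚ ℂ} {s : ℕ} (hlow : RelOnRank E E'' s) {k : ℕ}
    {y : Fin k → ℂ} {w : Fin (s + 1) → ℂ} (hy : ∀ i, y i ∈ E) (hwE : ∀ j, w j ∈ E'')
    (hw : LinearIndependent ℚ (E.mkQ ∘ w))
    (hcost : Algebra.trdeg ↥(adjoin ℚ (Set.range y ∪ Set.range (cexp ∘ y)))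
      ↥(adjoin ↥(adjoin ℚ (Set.range y ∪ Set.range (cexp ∘ y))) (Set.range w ∪ Set.range (cexp ∘ w))) ≤
      ((s + 1 : ℕ) : Cardinal)) :
    HBlock E w ∧ ∀ j, w j ∈ blockStep (s + 1) E := by
  have hV : span ℚ (Set.range w) ≤ E'' := span_le.mpr (Set.range_subset_iff.mpr hwE)
  have hB : HBlock E w := hblock_of_cost_le_local hy hw
    (fun c τ _ hcs hτV hτE => hlow k c y τ (by omega) hy (fun i => hV (hτV i)) hτE) hcost
  exact ⟨hB, fun j => mem_blockStep_of_hblock le_rfl hB j⟩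

/-- **`BlockExactOn E E'' → Rel(E''|E)`** (any `E`, `E''`; no block-closedness): by induction on the rank, a
first failure would be a block — exact by hypothesis. -/
theorem relOnRank_of_blockExactOn {E E'' : Submodule ℚ ℂ} (h : BlockExactOn E E'') :
    ∀ M, RelOnRank E E'' M := by
  intro M
  induction M with
  | zero =>
    intro k m y z hm hy hz hli
    obtain rfl : m = 0 := Nat.le_zero.mp hm
    simp
  | succ s ih =>
    intro k m y z hm hy hz hli
    rcases Nat.lt_or_ge m (s + 1) with hlt | hge
    · exact ih k m y z (by omega) hy hz hli
    · obtain rfl : m = s + 1 := le_antisymm hm hge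
      by_contra hlt
      exact hlt (h (s + 1) z hz (hblock_of_relOnRank ih hy hz hli (le_of_lt (not_le.mp hlt))).1 hli k y hy)

/-- **`Rel(E''|E)` ⟺ every free hereditary block over `E` inside `E''` is EXACT.** -/
theorem forall_relOnRank_iff_blockExactOn (E E'' : Submodule ℚ ℂ) :
    (∀ M, RelOnRank E E'' M) ↔ BlockExactOn E E'' :=
  ⟨blockExactOn_of_forall_relOnRank, relOnRank_of_blockExactOn⟩

/-- The same over the written-out `Rel(E''|E)`. -/
theorem rel_iff_blockExactOn (E E'' : Submodule ℚ ℂ) :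
    (∀ (k m : ℕ) (y : Fin k → ℂ) (z : Fin m → ℂ), (∀ i, y i ∈ E) → (∀ j, z j ∈ E'') →
      LinearIndependent ℚ ((E).mkQ ∘ z) →
      (m : Cardinal) ≤ Algebra.trdeg ↥(adjoin ℚ (Set.range y ∪ Set.range (cexp ∘ y)))
        ↥(adjoin ↥(adjoin ℚ (Set.range y ∪ Set.range (cexp ∘ y)))
          (Set.range z ∪ Set.range (cexp ∘ z)))) ↔ BlockExactOn E E'' :=
  (rel_iff_forall_relOnRank E E'').trans (forall_relOnRank_iff_blockExactOn E E'')

/-- **DEPTH ONE.** `Rel(⊤|E) ↔ ∀ m, Rel(E^{B≤m}|E)`: relative Schanuel over `E` holds everywhere as soon as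
it holds on each SINGLE block step — a first failure never needs iterated or mixed adjunctions. -/
theorem forall_relOnRank_top_iff_forall_blockStep (E : Submodule ℚ ℂ) :
    (∀ M, RelOnRank E ⊤ M) ↔ ∀ n M, RelOnRank E (blockStep n E) M := by
  refine ⟨fun h n M => relOnRank_mono_right le_top (h M), fun h => relOnRank_of_blockExactOn ?_⟩
  intro n w _ hB hw k y hy
  exact h n n k n y w le_rfl hy (fun j => mem_blockStep_of_hblock le_rfl hB j) hw

/-! ### §3 The items K₃ = 30523 and G₂ = 30522 by name -/

/-- `K₃ ↔ ∀ M, Rel(⊤|𝓚₂)[rank ≤ M]` (the item `SchanuelOverPairClosedFields` unfolded; `𝓚₂` literally). -/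
theorem pK3_iff_forall_relOnRank : SchanuelOverPairClosedFields ↔ ∀ M, RelOnRank ((⨆ n : ℕ, (fun E : Submodule ℚ ℂ => E ⊔ Submodule.span ℚ {x : ℂ | ∃ N : ℕ, N ≤ 2 ∧ ∃ w : Fin N → ℂ, (∃ Y : Finset ℂ, (↑Y : Set ℂ) ⊆ ↑E ∧ ∀ T : Finset ℂ, Y ⊆ T → ∀ (r : ℕ) (ρ : Fin r → Fin N), (∀ j, w j ∈ Submodule.span ℚ ((↑T : Set ℂ) ∪ Set.range (w ∘ ρ))) → Algebra.trdeg ↥(IntermediateField.adjoin ℚ ((↑T : Set ℂ) ∪ Complex.exp '' ↑T)) ↥(IntermediateField.adjoin ↥(IntermediateField.adjoin ℚ ((↑T : Set ℂ) ∪ Complex.exp '' ↑T)) (Set.range w ∪ Set.range (Complex.exp ∘ w))) ≤ r) ∧ x ∈ Set.range w})^[n + 1] (⨆ n : ℕ, (fun E : Submodule ℚ ℂ => E ⊔ Submodule.span ℚ {g : ℂ | ∃ Y : Finset ℂ, (↑Y : Set ℂ) ⊆ ↑E ∧ Algebra.trdeg ↥(IntermediateField.adjoin ℚ ((↑Y :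 Set ℂ) ∪ Complex.exp '' ↑Y)) ↥(IntermediateField.adjoin ↥(IntermediateField.adjoin ℚ ((↑Y : Set ℂ) ∪ Complex.exp '' ↑Y)) ({g, Complex.exp g} : Set ℂ)) ≤ 1})^[n + 1] (⨆ n : ℕ, (fun E : Submodule ℚ ℂ => (E ⊔ Submodule.span ℚ (Complex.exp '' ↑E)) ⊔ Submodule.span ℚ (Complex.exp ⁻¹' ↑(E ⊔ Submodule.span ℚ (Complex.exp '' ↑E))))^[n + 1] (Submodule.span ℚ ({z : ℂ | IsAlgebraic ℚ z} ∪ {z : ℂ | ∃ β l : ℂ, IsAlgebraic ℚ β ∧ IsAlgebraic ℚ (Complex.exp l) ∧ z = β * l})))))) ⊤ M :=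
  ⟨fun h _ k m y z _ hy _ hz => h k m y z hy hz,
    fun h k m y z hy hz => h m k m y z le_rfl hy (fun _ => Submodule.mem_top) hz⟩

/-- **K₃ ⟺ no `ℚ`-free hereditary block over the pair hull `𝓚₂` is over-determined.** -/
theorem pK3_iff_blockExactOn : SchanuelOverPairClosedFields ↔ BlockExactOn ((⨆ n : ℕ, (fun E : Submodule ℚ ℂ => E ⊔ Submodule.span ℚ {x : ℂ | ∃ N : ℕ, N ≤ 2 ∧ ∃ w : Fin N → ℂ, (∃ Y : Finset ℂ, (↑Y : Set ℂ) ⊆ ↑E ∧ ∀ T : Finset ℂ, Y ⊆ T → ∀ (r : ℕ) (ρ : Fin r → Fin N), (∀ j, w j ∈ Submodule.span ℚ ((↑T : Set ℂ) ∪ Set.range (w ∘ ρ))) → Algebra.trdeg ↥(IntermediateField.adjoin ℚ ((↑T : Set ℂ) ∪ Complex.exp '' ↑T)) ↥(IntermediateField.adjoin ↥(IntermediateField.adjoin ℚ ((↑T : Set ℂ) ∪ Complex.exp '' ↑T)) (Set.range w ∪ Set.range (Complex.exp ∘ w))) ≤ r) ∧ x ∈ Set.range w})^[n + 1] (⨆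 n : ℕ, (fun E : Submodule ℚ ℂ => E ⊔ Submodule.span ℚ {g : ℂ | ∃ Y : Finset ℂ, (↑Y : Set ℂ) ⊆ ↑E ∧ Algebra.trdeg ↥(IntermediateField.adjoin ℚ ((↑Y : Set ℂ) ∪ Complex.exp '' ↑Y)) ↥(IntermediateField.adjoin ↥(IntermediateField.adjoin ℚ ((↑Y : Set ℂ) ∪ Complex.exp '' ↑Y)) ({g, Complex.exp g} : Set ℂ)) ≤ 1})^[n + 1] (⨆ n : ℕ, (fun E : Submodule ℚ ℂ => (E ⊔ Submodule.span ℚ (Complex.exp '' ↑E)) ⊔ Submodule.span ℚ (Complex.exp ⁻¹' ↑(E ⊔ Submodule.span ℚ (Complex.exp '' ↑E))))^[n + 1] (Submodule.span ℚ ({z : ℂ | IsAlgebraic ℚ z} ∪ {z : ℂ | ∃ β l : ℂ, IsAlgebraic ℚ β ∧ IsAlgebraic ℚ (Complex.exp l) ∧ z = β * l})))))) ⊤ :=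
  pK3_iff_forall_relOnRank.trans (forall_relOnRank_iff_blockExactOn _ _)

/-- **K₃, DEPTH ONE: `K₃ ↔ ∀ m, Rel(𝓚₂^{B≤m}|𝓚₂)`** — a first failure of K₃ is a free `m`-block over `𝓚₂`
adjoined in ONE step (and `m ≥ 4`, `RootDecomp1JRankKernel.pairHull_rank_le_three_lit`). -/
theorem pK3_iff_forall_blockStep :
    SchanuelOverPairClosedFields ↔ ∀ n M, RelOnRank ((⨆ n : ℕ, (fun E : Submodule ℚ ℂ => E ⊔ Submodule.span ℚ {x : ℂ | ∃ N : ℕ, N ≤ 2 ∧ ∃ w : Fin N → ℂ, (∃ Y : Finset ℂ, (↑Y : Set ℂ) ⊆ ↑E ∧ ∀ T : Finset ℂ, Y ⊆ T → ∀ (r : ℕ) (ρ : Fin r → Fin N), (∀ j, w j ∈ Submodule.span ℚ ((↑T : Set ℂ) ∪ Set.range (w ∘ ρ))) → Algebra.trdeg ↥(IntermediateField.adjoin ℚ ((↑T : Set ℂ) ∪ Complex.exp '' ↑T)) ↥(IntermediateField.adjoin ↥(IntermediateField.adjoin ℚ ((↑T : Set ℂ) ∪ Complex.exp '' ↑T))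 (Set.range w ∪ Set.range (Complex.exp ∘ w))) ≤ r) ∧ x ∈ Set.range w})^[n + 1] (⨆ n : ℕ, (fun E : Submodule ℚ ℂ => E ⊔ Submodule.span ℚ {g : ℂ | ∃ Y : Finset ℂ, (↑Y : Set ℂ) ⊆ ↑E ∧ Algebra.trdeg ↥(IntermediateField.adjoin ℚ ((↑Y : Set ℂ) ∪ Complex.exp '' ↑Y)) ↥(IntermediateField.adjoin ↥(IntermediateField.adjoin ℚ ((↑Y : Set ℂ) ∪ Complex.exp '' ↑Y)) ({g, Complex.exp g} : Set ℂ)) ≤ 1})^[n + 1] (⨆ n : ℕ, (fun E : Submodule ℚ ℂ => (E ⊔ Submodule.span ℚ (Complex.exp '' ↑E)) ⊔ Submodule.span ℚ (Complex.exp ⁻¹' ↑(E ⊔ Submodule.span ℚ (Complex.exp '' ↑E))))^[n + 1] (Submodule.span ℚ ({z : ℂ | IsAlgebraic ℚ z} ∪ {z : ℂ | ∃ β l : ℂ, IsAlgebraic ℚ β ∧ IsAlgebraic ℚ (Complex.exp l) ∧ z = β * l})))))) (blockStep n ((⨆ n : ℕ, (fun E : Submodule ℚ ℂ => E ⊔ Submodule.span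 ℚ {x : ℂ | ∃ N : ℕ, N ≤ 2 ∧ ∃ w : Fin N → ℂ, (∃ Y : Finset ℂ, (↑Y : Set ℂ) ⊆ ↑E ∧ ∀ T : Finset ℂ, Y ⊆ T → ∀ (r : ℕ) (ρ : Fin r → Fin N), (∀ j, w j ∈ Submodule.span ℚ ((↑T : Set ℂ) ∪ Set.range (w ∘ ρ))) → Algebra.trdeg ↥(IntermediateField.adjoin ℚ ((↑T : Set ℂ) ∪ Complex.exp '' ↑T)) ↥(IntermediateField.adjoin ↥(IntermediateField.adjoin ℚ ((↑T : Set ℂ) ∪ Complex.exp '' ↑T)) (Set.range w ∪ Set.range (Complex.exp ∘ w))) ≤ r) ∧ x ∈ Set.range w})^[n + 1] (⨆ n : ℕ, (fun E : Submodule ℚ ℂ => E ⊔ Submodule.span ℚ {g : ℂ | ∃ Y : Finset ℂ, (↑Y : Set ℂ) ⊆ ↑E ∧ Algebra.trdeg ↥(IntermediateField.adjoin ℚ ((↑Y : Set ℂ) ∪ Complex.exp '' ↑Y)) ↥(IntermediateField.adjoin ↥(IntermediateField.adjoin ℚ ((↑Y : Set ℂ) ∪ Complex.exp '' ↑Y))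 ({g, Complex.exp g} : Set ℂ)) ≤ 1})^[n + 1] (⨆ n : ℕ, (fun E : Submodule ℚ ℂ => (E ⊔ Submodule.span ℚ (Complex.exp '' ↑E)) ⊔ Submodule.span ℚ (Complex.exp ⁻¹' ↑(E ⊔ Submodule.span ℚ (Complex.exp '' ↑E))))^[n + 1] (Submodule.span ℚ ({z : ℂ | IsAlgebraic ℚ z} ∪ {z : ℂ | ∃ β l : ℂ, IsAlgebraic ℚ β ∧ IsAlgebraic ℚ (Complex.exp l) ∧ z = β * l}))))))) M :=
  pK3_iff_forall_relOnRank.trans (forall_relOnRank_top_iff_forall_blockStep _)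

/-- `G₂ ↔ ∀ M, Rel(𝓚₂|𝓚)[rank ≤ M]` (the item `PairBlocksOverCurveClosedFields` unfolded). -/
theorem pG2_iff_forall_relOnRank : PairBlocksOverCurveClosedFields ↔ ∀ M, RelOnRank ((⨆ n : ℕ, (fun E : Submodule ℚ ℂ => E ⊔ Submodule.span ℚ {g : ℂ | ∃ Y : Finset ℂ, (↑Y : Set ℂ) ⊆ ↑E ∧ Algebra.trdeg ↥(IntermediateField.adjoin ℚ ((↑Y : Set ℂ) ∪ Complex.exp '' ↑Y)) ↥(IntermediateField.adjoin ↥(IntermediateField.adjoin ℚ ((↑Y : Set ℂ) ∪ Complex.exp '' ↑Y)) ({g, Complex.exp g} : Set ℂ)) ≤ 1})^[n + 1] (⨆ n : ℕ, (fun E : Submodule ℚ ℂ => (E ⊔ Submodule.span ℚ (Complex.exp '' ↑E)) ⊔ Submodule.span ℚ (Complex.exp ⁻¹' ↑(E ⊔ Submodule.span ℚ (Complex.exp '' ↑E))))^[n + 1] (Submodule.span ℚ ({z : ℂ | IsAlgebraic ℚ z} ∪ {z : ℂ | ∃ β l : ℂ, IsAlgebraic ℚ β ∧ IsAlgebraic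 ℚ (Complex.exp l) ∧ z = β * l}))))) ((⨆ n : ℕ, (fun E : Submodule ℚ ℂ => E ⊔ Submodule.span ℚ {x : ℂ | ∃ N : ℕ, N ≤ 2 ∧ ∃ w : Fin N → ℂ, (∃ Y : Finset ℂ, (↑Y : Set ℂ) ⊆ ↑E ∧ ∀ T : Finset ℂ, Y ⊆ T → ∀ (r : ℕ) (ρ : Fin r → Fin N), (∀ j, w j ∈ Submodule.span ℚ ((↑T : Set ℂ) ∪ Set.range (w ∘ ρ))) → Algebra.trdeg ↥(IntermediateField.adjoin ℚ ((↑T : Set ℂ) ∪ Complex.exp '' ↑T)) ↥(IntermediateField.adjoin ↥(IntermediateField.adjoin ℚ ((↑T : Set ℂ) ∪ Complex.exp '' ↑T)) (Set.range w ∪ Set.range (Complex.exp ∘ w))) ≤ r) ∧ x ∈ Set.range w})^[n + 1] (⨆ n : ℕ, (fun E : Submodule ℚ ℂ => E ⊔ Submodule.span ℚ {g : ℂ | ∃ Y : Finset ℂ, (↑Y : Set ℂ) ⊆ ↑E ∧ Algebra.trdeg ↥(IntermediateField.adjoin ℚ ((↑Y : Set ℂ) ∪ Complex.exp '' ↑Y))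 ↥(IntermediateField.adjoin ↥(IntermediateField.adjoin ℚ ((↑Y : Set ℂ) ∪ Complex.exp '' ↑Y)) ({g, Complex.exp g} : Set ℂ)) ≤ 1})^[n + 1] (⨆ n : ℕ, (fun E : Submodule ℚ ℂ => (E ⊔ Submodule.span ℚ (Complex.exp '' ↑E)) ⊔ Submodule.span ℚ (Complex.exp ⁻¹' ↑(E ⊔ Submodule.span ℚ (Complex.exp '' ↑E))))^[n + 1] (Submodule.span ℚ ({z : ℂ | IsAlgebraic ℚ z} ∪ {z : ℂ | ∃ β l : ℂ, IsAlgebraic ℚ β ∧ IsAlgebraic ℚ (Complex.exp l) ∧ z = β * l})))))) M :=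
  rel_iff_forall_relOnRank _ _

/-- **G₂ ⟺ every `ℚ`-free hereditary block over `𝓚` inside `𝓚₂` is exact.** -/
theorem pG2_iff_blockExactOn : PairBlocksOverCurveClosedFields ↔ BlockExactOn ((⨆ n : ℕ, (fun E : Submodule ℚ ℂ => E ⊔ Submodule.span ℚ {g : ℂ | ∃ Y : Finset ℂ, (↑Y : Set ℂ) ⊆ ↑E ∧ Algebra.trdeg ↥(IntermediateField.adjoin ℚ ((↑Y : Set ℂ) ∪ Complex.exp '' ↑Y)) ↥(IntermediateField.adjoin ↥(IntermediateField.adjoin ℚ ((↑Y : Set ℂ) ∪ Complex.exp '' ↑Y)) ({g, Complex.exp g} : Set ℂ)) ≤ 1})^[n + 1] (⨆ n : ℕ, (fun E : Submodule ℚ ℂ => (E ⊔ Submodule.span ℚ (Complex.exp '' ↑E)) ⊔ Submodule.span ℚ (Complex.exp ⁻¹' ↑(E ⊔ Submodule.span ℚ (Complex.exp '' ↑E))))^[n + 1] (Submodule.span ℚ ({z : ℂ | IsAlgebraic ℚ z} ∪ {z : ℂ | ∃ β l : ℂ, IsAlgebraic ℚ β ∧ IsAlgebraic ℚ (Complex.exp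 l) ∧ z = β * l}))))) ((⨆ n : ℕ, (fun E : Submodule ℚ ℂ => E ⊔ Submodule.span ℚ {x : ℂ | ∃ N : ℕ, N ≤ 2 ∧ ∃ w : Fin N → ℂ, (∃ Y : Finset ℂ, (↑Y : Set ℂ) ⊆ ↑E ∧ ∀ T : Finset ℂ, Y ⊆ T → ∀ (r : ℕ) (ρ : Fin r → Fin N), (∀ j, w j ∈ Submodule.span ℚ ((↑T : Set ℂ) ∪ Set.range (w ∘ ρ))) → Algebra.trdeg ↥(IntermediateField.adjoin ℚ ((↑T : Set ℂ) ∪ Complex.exp '' ↑T)) ↥(IntermediateField.adjoin ↥(IntermediateField.adjoin ℚ ((↑T : Set ℂ) ∪ Complex.exp '' ↑T)) (Set.range w ∪ Set.range (Complex.exp ∘ w))) ≤ r) ∧ x ∈ Set.range w})^[n + 1] (⨆ n : ℕ, (fun E : Submodule ℚ ℂ => E ⊔ Submodule.span ℚ {g : ℂ | ∃ Y : Finset ℂ, (↑Y : Set ℂ) ⊆ ↑E ∧ Algebra.trdeg ↥(IntermediateField.adjoin ℚ ((↑Y : Set ℂ) ∪ Complex.exp '' ↑Y)) ↥(IntermediateField.adjoin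 ↥(IntermediateField.adjoin ℚ ((↑Y : Set ℂ) ∪ Complex.exp '' ↑Y)) ({g, Complex.exp g} : Set ℂ)) ≤ 1})^[n + 1] (⨆ n : ℕ, (fun E : Submodule ℚ ℂ => (E ⊔ Submodule.span ℚ (Complex.exp '' ↑E)) ⊔ Submodule.span ℚ (Complex.exp ⁻¹' ↑(E ⊔ Submodule.span ℚ (Complex.exp '' ↑E))))^[n + 1] (Submodule.span ℚ ({z : ℂ | IsAlgebraic ℚ z} ∪ {z : ℂ | ∃ β l : ℂ, IsAlgebraic ℚ β ∧ IsAlgebraic ℚ (Complex.exp l) ∧ z = β * l})))))) :=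
  rel_iff_blockExactOn _ _

end Summit.Schanuel.Schanuel.Theorems.RootDecomp1JFirstFailure
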